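/-
Copyright (c) 2026 the pub-hodgecm-mathlib formalisation cell (harness21).  Prover seat hodgecm-mathlib-LH4-p18 (g3), Track A «FOUR-FRAME» hand on VALVE loan to
Track B «K2-LIT», #184♮ = hLiu418 = `stmt-HodgeConjecture-24832`; socket #41, KIND 1 (K1-b♮ LINE TERM), organ (K1b-W) «KIND W AT `n := 1` FOR THE PULLED-BACK FAMILY»
— LEAD F0P6-plan (g14) BATCH #100 (2), line lead K2Liu-p14 (g4) LINE WORD #3 (3) EXPORT RULING (2026-09-04T22:51:39Z); file (KW1-pkg), the FINE-FORM sibling of ★ p862765.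
THEOREMS ONLY (no `def`, no `instance`, no notation, no named-fact hypothesis, no `sorry`).
-/
import Summits.HodgeConjecture.HodgeConjecture.Theorems.K2LiuKindOneLineWhittakerPackage     -- ★ p862765 (this seat): `differentiableOn_linePart`, `exists_kindW_line_letters_of_letters`
import HarnessLib

/-!
# Crux `HLiu418`, socket #41, KIND 1 ∕ organ (K1b-W), file (KW1-pkg) FINE — `K2LiuKindOneLineWhittakerPackageFine`: THE ∃-PACKAGE HEAD OF KIND W AT `n := 1` CARRYING THE
# LINE LEAD's EXPORT RULING — the INTRINSIC («fine-form») decay letter about the SAME `T`-part travels INSIDE the ∃, next to the TOP-shape block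

Cell `hodgecm-mathlib`, crux item hLiu418 = `stmt-HodgeConjecture-24832` (helper lane `--supports … --as helper`, count-neutral), route of record `HCCMUnconditional`;
squad K2 ∕ K2Liu, road `K2_Liu`, socket #41 `sig_K2LiuSiegelEisensteinContinuation`.  Sibling of ★ `K2LiuKindOneLineWhittakerPackage` (the STAGE-1, currency-free ∃-package
of the `(μ, g)`-letters at `n := 1`: `∃ A₁ U₁, hEuler₁ ∧ hAd₁ ∧ ∃ τ₁ NW₁, hτ₁ ∧ hdec₁ ∧ ∃ CW₁ κ₁, 0 < CW₁ ∧ 0 ≤ κ₁ ∧ hsupp₁`, consumed by the (K1b-♮) assembly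
`K2LiuKindOneLineTermPackage` of LH4-p14 (g7) as its antecedent `hKW : ∀ p₀ hp₀ g, …`).  Line lead K2Liu-p14 (g4), LINE WORD #3 (3) (Q2) + EXPORT RULING (binding for
(d)(e∞)(f)): the K1-b♮ assembly must NOT route the line term's decay through the height `‖Λĝ(S)·h‖` of the rational row section (a power of the line height would land
inside the exponential and `Σ_w` diverges); it needs the INTRINSIC decay `‖A₁ μ s g‖ ≤ C(z) · F_fin(μ, g_f) · |a₀₀(g_∞)|^{e(s)} · (1 + |a₀₀(g_∞)|²|μ|_∞)^N · e^{−π Σ_{w∣∞}|a₀₀(g_w)|²|μ|_w}`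
(`a₀₀` the Levi coordinate of the translate: ★ (KW1-d) ED. 2 `K2LiuKindOneLineWhittakerIwasawa.norm_lineWhittaker_iwasawa_le` is this letter at `∞` for the scalar-type line
section; (KW1-e∞) `K2LiuKindOneLineCornerArchReading` reads the corner translate at the Iwasawa point) — «LH4-p18: carry both conjuncts».  Since the ∃ of the package HIDES
`A₁`, a letter about the same `A₁` is usable downstream only if it is packed WITH it; this file does exactly that, currency-free as its sibling: the fine majorant is an
ABSTRACT `B : ι → ℂ → X → ℝ` supplied by the consumer in the producers' bytes, and the letter is «`‖A₁ μ s x‖ ≤ C(z) · B μ s x` locally uniformly in `s`, uniformly in `(μ, x)`».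
* §1 **`exists_kindW_line_letters_of_letters_fine`** — the hypotheses of ★ `exists_kindW_line_letters_of_letters` plus `(B, hfine)` ⟹
  `∃ A₁ U₁, hEuler₁ ∧ hAd₁ ∧ (∃ τ₁ NW₁, hτ₁ ∧ hdec₁ ∧ ∃ CW₁ κ₁, 0 < CW₁ ∧ 0 ≤ κ₁ ∧ hsupp₁) ∧ hfine` (`hAd₁` by ★ `differentiableOn_linePart`, the KEY FACT «continued = integral»).
[MoeglinWaldspurger1995, II.1.7, IV.1.9] [KudlaRallis1994, §1–§2] [Shimura1997, §18.4 Prop. 18.14] [Tan1999, §3].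
HONEST LABEL.  Count-neutral helper, closes no socket; every sibling head enters BY VALUE: `HC_CM` is proved only modulo the 7 printed citations (2 remaining named inputs:
hLiu418 = `stmt-HodgeConjecture-24832`, h413 = `stmt-HodgeConjecture-24833`) until rung 0 closes.

## References
* [MoeglinWaldspurger1995] C. Mœglin, J.-L. Waldspurger, *Spectral decomposition and Eisenstein series*, CUP (1995): II.1.7, IV.1.9.
* [KudlaRallis1994] S. Kudla, S. Rallis, *A regularized Siegel–Weil formula: the first term identity*, Ann. of Math. 140 (1994): §1–§2.
* [Shimura1997] G. Shimura, *Euler Products and Eisenstein Series*, CBMS 93 (1997): §18.4 Prop. 18.14 (rapid decay of the archimedean confluent factor).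
* [Tan1999] V. Tan, *Poles of Siegel Eisenstein series on U(n,n)*, Canad. J. Math. 51 (1999): §3.
-/

set_option autoImplicit false
set_option linter.dupNamespace false -- the mandated namespace repeats `HodgeConjecture.HodgeConjecture`

noncomputable section

open scoped Matrix NNReal
-- `Classical` is needed to see the Mathlib normed-ring instances on `mixedSpace L` (note H5 of ★ `AdelicGLnGlue`; as the TOP's `hτ`)
open scoped Classical
open NumberField IsDedekindDomain MeasureTheory

namespace Summit.HodgeConjecture.HodgeConjecture.Cruxes.HLiu418.K2LiuKindOneLineWhittakerPackageFine

open Literature.NumberTheory.Automorphic Literature.NumberTheory.GaloisRepresentations Literature.NumberTheory.LFunctions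
open Literature.NumberTheory.GelbartRogawski1991 Literature.NumberTheory.GelbartRogawski1991.GRConstruction
open Literature.NumberTheory.K2Lit.SiegelDoubled
open Summit.HodgeConjecture.HodgeConjecture.Cruxes.HLiu418.K2LiuSiegelUnipotentFourierDefs
open Summit.HodgeConjecture.HodgeConjecture.Cruxes.HLiu418.K2LiuKindOneLineWhittakerPackage (differentiableOn_linePart)

/-! ## §1 The EXPORT RULING: a FINE-FORM letter about the SAME `T`-part travels INSIDE the ∃ (line lead LINE WORD #3 (3), 2026-09-04T22:51:39Z)

The ∃ of ★ `exists_kindW_line_letters_of_letters` hides `A₁`; every further letter the (K1b-♮) assembly needs about THE SAME `A₁` must therefore be packed with it.  The line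
lead's EXPORT RULING asks for the INTRINSIC («fine-form») decay `‖A₁ μ s g‖ ≤ C(z) · F_fin(μ, g_f) · |a₀₀(g_∞)|^{e(s)} · (1 + |a₀₀(g_∞)|²|μ|_∞)^N · e^{−π Σ_{w∣∞} |a₀₀(g_w)|²|μ|_w}` (Levi coordinate `a₀₀` of the
translate, ★ (KW1-d) ED. 2 `K2LiuKindOneLineWhittakerIwasawa.norm_lineWhittaker_iwasawa_le` at `∞`, (KW1-e∞) `K2LiuKindOneLineCornerArchReading` for the reading) BESIDES the
TOP-shape height form `hdec₁`.  Currency-free as the rest of this file: the fine majorant is an ABSTRACT function `B : ι → ℂ → X → ℝ` of (index, parameter, point) supplied by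
the consumer in the producers' bytes, and the letter is «locally uniformly in `s`, uniformly in `(μ, x)`: `‖A₁ μ s x‖ ≤ C(z) · B μ s x`». -/

section Fine

variable (L : Type) [Field L] [NumberField L] [IsCMField L]
variable {N₁ M₁ : ℕ} (e₁ : Fin N₁ × Fin M₁ ≃ Fin 1)
  (d₁ : Fin N₁ → L) (hd₁ : ∀ i, IsCMField.complexConj L (d₁ i) = d₁ i) (w₁ : Fin M₁ → L) (hw₁ : ∀ i, IsCMField.complexConj L (w₁ i) = w₁ i)

/-- **KIND W AT `n := 1` — THE ∃-PACKAGE HEAD CARRYING THE FINE FORM** (EXPORT RULING).  As `exists_kindW_line_letters_of_letters`, plus ONE more letter BY VALUE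
about the same `T`-part — a FINE MAJORANT `B : ι → ℂ → X → ℝ` (the consumer reads `B μ s g := F_fin(μ, g_f) · ∏_{w∣∞} |a₀₀(g_w)|^{1 − 2 re s} (1 + |a₀₀(g_w)|²|μ|_w) e^{−π|a₀₀(g_w)|²|μ|_w}`
in the bytes of ★ (KW1-d) ED. 2 ∕ (KW1-e∞)) with `hfine : ∀ z, 0 < re z → ∃ C r, 0 ≤ C ∧ 0 < r ∧ ∀ μ s, dist s z < r → ∀ x, ‖A₁ μ s x‖ ≤ C · B μ s x` — re-exported as the
LAST conjunct of the block, INSIDE the ∃ over `(A₁, U₁)`: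
`∃ A₁ U₁, hEuler₁ ∧ hAd₁ ∧ (∃ τ₁ NW₁, hτ₁ ∧ hdec₁ ∧ ∃ CW₁ κ₁, 0 < CW₁ ∧ 0 ≤ κ₁ ∧ hsupp₁) ∧ hfine`.
[cite: MoeglinWaldspurger1995, II.1.7, IV.1.9] [cite: KudlaRallis1994, §1–§2] [cite: Shimura1997, §18.4 Prop. 18.14] [cite: Tan1999, §3] -/
theorem exists_kindW_line_letters_of_letters_fine
    [MeasurableSpace (unipDelta L e₁ d₁ hd₁ w₁ hw₁)] (ν₁ : Measure (unipDelta L e₁ d₁ hd₁ w₁ hw₁))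
    {X : Type*} {N : ℕ} (ht : X → GL (Fin N) (AdeleRing (𝓞 L) L)) (Φ : X → ℂ → HA L e₁ d₁ hd₁ w₁ hw₁ → ℂ)
    (A₁ : skewMatrices ((IsCMField.complexConj L : L ≃ₐ[Fp L] L) : L →+* L) ((gramR L e₁ d₁ hd₁ w₁ hw₁).map (algebraMap (Fp L) L)) → ℂ → X → ℂ)
    (U₁ : skewMatrices ((IsCMField.complexConj L : L ≃ₐ[Fp L] L) : L →+* L) ((gramR L e₁ d₁ hd₁ w₁ hw₁).map (algebraMap (Fp L) L)) → X →
      Set (HeightOneSpectrum (𝓞 ↥(maximalRealSubfield L))))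
    (hEuler₁ : ∀ μ : skewMatrices ((IsCMField.complexConj L : L ≃ₐ[Fp L] L) : L →+* L) ((gramR L e₁ d₁ hd₁ w₁ hw₁).map (algebraMap (Fp L) L)),
      (μ : Matrix (Fin 1) (Fin 1) L).det ≠ 0 → ∀ (s : ℂ) (x : X), 0 < s.re →
        whittakerDelta L e₁ d₁ hd₁ w₁ hw₁ ν₁ (μ : Matrix (Fin 1) (Fin 1) L) (Φ x s) 1 =
          A₁ μ s x * (partialStandardL (U₁ μ x) (fun v => {(quadraticHeckeCharCM L).valueAtUniformizer v}) (2 * (s + 1 / 2) + 1))⁻¹)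
    (hdet0 : ∀ (μ : skewMatrices ((IsCMField.complexConj L : L ≃ₐ[Fp L] L) : L →+* L) ((gramR L e₁ d₁ hd₁ w₁ hw₁).map (algebraMap (Fp L) L)))
      (s : ℂ) (x : X), (μ : Matrix (Fin 1) (Fin 1) L).det = 0 → A₁ μ s x = 0)
    (hW₁ : ∀ (μ : skewMatrices ((IsCMField.complexConj L : L ≃ₐ[Fp L] L) : L →+* L) ((gramR L e₁ d₁ hd₁ w₁ hw₁).map (algebraMap (Fp L) L))) (x : X),
      (μ : Matrix (Fin 1) (Fin 1) L).det ≠ 0 →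
        DifferentiableOn ℂ (fun s => whittakerDelta L e₁ d₁ hd₁ w₁ hw₁ ν₁ (μ : Matrix (Fin 1) (Fin 1) L) (Φ x s) 1) {s : ℂ | 0 < s.re})
    (τ₁ : skewMatrices ((IsCMField.complexConj L : L ≃ₐ[Fp L] L) : L →+* L) ((gramR L e₁ d₁ hd₁ w₁ hw₁).map (algebraMap (Fp L) L)) → ℝ)
    (hτ₁ : ∀ μ : skewMatrices ((IsCMField.complexConj L : L ≃ₐ[Fp L] L) : L →+* L) ((gramR L e₁ d₁ hd₁ w₁ hw₁).map (algebraMap (Fp L) L)),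
      ‖(fun i j => NumberField.mixedEmbedding L ((μ : Matrix (Fin 1) (Fin 1) L) i j))‖ ≤ τ₁ μ) (NW₁ : ℕ)
    (hdec₁ : ∀ z : ℂ, 0 < z.re → ∃ C a c a' r : ℝ, 0 ≤ C ∧ 0 ≤ a ∧ 0 < c ∧ 0 ≤ a' ∧ 0 < r ∧ ∀ μ (s : ℂ), dist s z < r → ∀ x : X,
      ‖A₁ μ s x‖ ≤ C * adelicHeightGL N L (ht x) ^ a * (Real.exp (-(c * adelicHeightGL N L (ht x) ^ (-a') * τ₁ μ)) * (1 + τ₁ μ) ^ NW₁))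
    {CW₁ κ₁ : ℝ} (hCW₁ : 0 < CW₁) (hκ₁ : 0 ≤ κ₁)
    (hsupp₁ : ∀ μ (s : ℂ) (x : X), 0 < s.re → A₁ μ s x ≠ 0 →
      ∃ D : ℕ, 1 ≤ D ∧ (D : ℝ) ≤ CW₁ * adelicHeightGL N L (ht x) ^ κ₁ ∧ ∀ i j, IsIntegral ℤ ((D : L) * (μ : Matrix (Fin 1) (Fin 1) L) i j))
    -- the FINE FORM by value: an intrinsic majorant `B`, locally uniform in `s`, uniform in `(μ, x)`
    (B : skewMatrices ((IsCMField.complexConj L : L ≃ₐ[Fp L] L) : L →+* L) ((gramR L e₁ d₁ hd₁ w₁ hw₁).map (algebraMap (Fp L) L)) → ℂ → X → ℝ)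
    (hfine : ∀ z : ℂ, 0 < z.re → ∃ C r : ℝ, 0 ≤ C ∧ 0 < r ∧ ∀ μ (s : ℂ), dist s z < r → ∀ x : X, ‖A₁ μ s x‖ ≤ C * B μ s x) :
    ∃ (A₁ : skewMatrices ((IsCMField.complexConj L : L ≃ₐ[Fp L] L) : L →+* L) ((gramR L e₁ d₁ hd₁ w₁ hw₁).map (algebraMap (Fp L) L)) → ℂ → X → ℂ)
      (U₁ : skewMatrices ((IsCMField.complexConj L : L ≃ₐ[Fp L] L) : L →+* L) ((gramR L e₁ d₁ hd₁ w₁ hw₁).map (algebraMap (Fp L) L)) → X →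
        Set (HeightOneSpectrum (𝓞 ↥(maximalRealSubfield L)))),
      (∀ μ : skewMatrices ((IsCMField.complexConj L : L ≃ₐ[Fp L] L) : L →+* L) ((gramR L e₁ d₁ hd₁ w₁ hw₁).map (algebraMap (Fp L) L)),
        (μ : Matrix (Fin 1) (Fin 1) L).det ≠ 0 → ∀ (s : ℂ) (x : X), 0 < s.re →
          whittakerDelta L e₁ d₁ hd₁ w₁ hw₁ ν₁ (μ : Matrix (Fin 1) (Fin 1) L) (Φ x s) 1 =
            A₁ μ s x * (partialStandardL (U₁ μ x) (fun v => {(quadraticHeckeCharCM L).valueAtUniformizer v}) (2 * (s + 1 / 2) + 1))⁻¹) ∧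
      (∀ μ (x : X), DifferentiableOn ℂ (fun s => A₁ μ s x) {s : ℂ | 0 < s.re}) ∧
      (∃ (τ₁ : skewMatrices ((IsCMField.complexConj L : L ≃ₐ[Fp L] L) : L →+* L) ((gramR L e₁ d₁ hd₁ w₁ hw₁).map (algebraMap (Fp L) L)) → ℝ) (NW₁ : ℕ),
        (∀ μ : skewMatrices ((IsCMField.complexConj L : L ≃ₐ[Fp L] L) : L →+* L) ((gramR L e₁ d₁ hd₁ w₁ hw₁).map (algebraMap (Fp L) L)),
          ‖(fun i j => NumberField.mixedEmbedding L ((μ : Matrix (Fin 1) (Fin 1) L) i j))‖ ≤ τ₁ μ) ∧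
        (∀ z : ℂ, 0 < z.re → ∃ C a c a' r : ℝ, 0 ≤ C ∧ 0 ≤ a ∧ 0 < c ∧ 0 ≤ a' ∧ 0 < r ∧ ∀ μ (s : ℂ), dist s z < r → ∀ x : X,
          ‖A₁ μ s x‖ ≤ C * adelicHeightGL N L (ht x) ^ a * (Real.exp (-(c * adelicHeightGL N L (ht x) ^ (-a') * τ₁ μ)) * (1 + τ₁ μ) ^ NW₁)) ∧
        ∃ CW₁ κ₁ : ℝ, 0 < CW₁ ∧ 0 ≤ κ₁ ∧
          ∀ μ (s : ℂ) (x : X), 0 < s.re → A₁ μ s x ≠ 0 →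
            ∃ D : ℕ, 1 ≤ D ∧ (D : ℝ) ≤ CW₁ * adelicHeightGL N L (ht x) ^ κ₁ ∧ ∀ i j, IsIntegral ℤ ((D : L) * (μ : Matrix (Fin 1) (Fin 1) L) i j)) ∧
      (∀ z : ℂ, 0 < z.re → ∃ C r : ℝ, 0 ≤ C ∧ 0 < r ∧ ∀ μ (s : ℂ), dist s z < r → ∀ x : X, ‖A₁ μ s x‖ ≤ C * B μ s x) :=
  ⟨A₁, U₁, hEuler₁,
    differentiableOn_linePart L
      (fun μ : skewMatrices ((IsCMField.complexConj L : L ≃ₐ[Fp L] L) : L →+* L) ((gramR L e₁ d₁ hd₁ w₁ hw₁).map (algebraMap (Fp L) L)) =>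
        (μ : Matrix (Fin 1) (Fin 1) L))
      (fun μ s x => whittakerDelta L e₁ d₁ hd₁ w₁ hw₁ ν₁ (μ : Matrix (Fin 1) (Fin 1) L) (Φ x s) 1) A₁ U₁ hW₁ hEuler₁ hdet0,
    ⟨τ₁, NW₁, hτ₁, hdec₁, CW₁, κ₁, hCW₁, hκ₁, hsupp₁⟩, hfine⟩

end Fine

end Summit.HodgeConjecture.HodgeConjecture.Cruxes.HLiu418.K2LiuKindOneLineWhittakerPackageFine

end
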